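import Summits.CriticalPhenomena.PercolationContinuityZ3.Theorems.PercNearOneGluingNoHeavyLowerTailSahiHittingAnyIndex
import Summits.CriticalPhenomena.PercolationContinuityZ3.Theorems.PercNearOneGluingNoHeavyLowerTailSahiHittingWidthFour
import HarnessLib

/-!
# `NoHeavyLowerTail` (stmt-CriticalPhenomena-4575) — hitting families of width ≤ 4 on ANY product space, every order (computational)

Support file, seat `prim-l12-p5` (gen 7), `--supports stmt-CriticalPhenomena-4575`, COMPUTATIONAL (through the kernel certificate
`hit4_check` of the hitting `C₄`, inherited from `…SahiHittingWidthFour`).  No definitions, no named facts, no sorries.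

The bridge `msahiE_prodBernoulli_hit_eq_sahiE` of `…SahiHittingAnyIndex` transports the width-≤-4 theorem of `…SahiHittingWidthFour`
from finite cubes to the product Bernoulli measure `prodBernoulli p` on `Set ι` for an ARBITRARY index type `ι`:

* **`msahiE_prodBernoulli_hit_nonneg_of_width_le_four`**: finite sets `A : Fin m → Finset ι` such that any five indices contain a nested
  pair have `0 ≤ E_m^{prodBernoulli p}(1_{H_{A_0}}, …, 1_{H_{A_{m−1}}})` for every `m`.
* `msahiE_prodBernoulli_hit_nonneg_of_four_sets`: any four finite sets with arbitrary multiplicities — Sahi's generating-function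
  conjecture (Conjecture 4 of [Sahi2008] / 1.2 of [LiebSahi2021]) for four hitting events of an arbitrary product space.
* `msahiE_prodBernoulli_hit_nonneg_of_width_le`: locality in width on any product space (std axioms): `C_1..C_k` for hitting families on
  every finite cube ⟹ every order for width ≤ `k` on every product space.
-/

noncomputable section

namespace Summit.CriticalPhenomena.PercolationContinuityZ3.Theorems

namespace SahiHitting

open MeasureTheory Finset Function Literature.Combinatorics.Sahi2008
open Literature.Probability.Percolation.DecisionTree (ind ind_of_mem ind_of_not_mem ind_nonneg)
open Literature.Probability.LatticeModels (prodBernoulli)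

universe u

variable {ι : Type u}

/-- **Locality in width, ANY product space**: if Sahi's `C_1, …, C_k` hold for hitting families on EVERY finite cube
(`k ≥ 1`), then on an arbitrary product space every finite family of hitting events of width ≤ `k` (any `k + 1` indices contain a
nested pair) has `E_m ≥ 0` at every order. [this work] -/
theorem msahiE_prodBernoulli_hit_nonneg_of_width_le {k : ℕ} (hk : 1 ≤ k)
    (hC : ∀ (κ : Type u) [Fintype κ] (q : κ → unitInterval) (j : ℕ), j ≤ k → ∀ (B : Fin j → Finset κ),
      0 ≤ sahiE (bernoulliWeight q) j (fun l => ind {ω : Set κ | ∃ a ∈ B l, a ∈ ω}))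
    (p : ι → unitInterval) (m : ℕ) (A : Fin m → Finset ι)
    (hw : ∀ S : Finset (Fin m), S.card = k + 1 → ∃ i ∈ S, ∃ j ∈ S, i ≠ j ∧ A i ⊆ A j) :
    0 ≤ msahiE (prodBernoulli p) m (fun l => ind {ω : Set ι | ∃ a ∈ A l, a ∈ ω}) := by
  classical
  let K : Finset ι := Finset.univ.biUnion A
  have hA : ∀ l, A l ⊆ K := fun l => Finset.subset_biUnion_of_mem A (Finset.mem_univ l)
  rw [msahiE_prodBernoulli_hit_eq_sahiE p K m A hA]
  refine prodBernoulli_sahiE_hit_nonneg_of_width_le _ hk (hC _ _) m _ fun S hS => ?_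
  obtain ⟨i, hi, j, hj, hij, hsub⟩ := hw S hS
  exact ⟨i, hi, j, hj, hij, subtype_subset_subtype_of_subset hsub⟩

/-- **Sahi positivity at every order, width ≤ 4, ANY product space** (computational): for an arbitrary index type `ι`,
`p : ι → [0,1]` and finite sets `A : Fin m → Finset ι` such that any five indices contain a nested pair,
`0 ≤ E_m^{prodBernoulli p}(1_{H_{A_0}}, …, 1_{H_{A_{m−1}}})`. [this work] -/
theorem msahiE_prodBernoulli_hit_nonneg_of_width_le_four (p : ι → unitInterval) (m : ℕ) (A : Fin m → Finset ι)
    (hw : ∀ S : Finset (Fin m), S.card = 5 → ∃ i ∈ S, ∃ j ∈ S, i ≠ j ∧ A i ⊆ A j) :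
    0 ≤ msahiE (prodBernoulli p) m (fun l => ind {ω : Set ι | ∃ a ∈ A l, a ∈ ω}) := by
  classical
  let K : Finset ι := Finset.univ.biUnion A
  have hA : ∀ l, A l ⊆ K := fun l => Finset.subset_biUnion_of_mem A (Finset.mem_univ l)
  rw [msahiE_prodBernoulli_hit_eq_sahiE p K m A hA]
  refine prodBernoulli_sahiE_hit_nonneg_of_width_le_four _ m _ fun S hS => ?_
  obtain ⟨i, hi, j, hj, hij, hsub⟩ := hw S hS
  exact ⟨i, hi, j, hj, hij, subtype_subset_subtype_of_subset hsub⟩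

/-- **Any four finite sets, arbitrary multiplicities, ANY product space** (computational): for `B : Fin 4 → Finset ι` and any
`c : Fin m → Fin 4`, `0 ≤ E_m(1_{H_{B_{c 0}}}, …, 1_{H_{B_{c (m−1)}}})` — every coefficient of Sahi's generating function of four
hitting events is nonnegative. [this work] -/
theorem msahiE_prodBernoulli_hit_nonneg_of_four_sets (p : ι → unitInterval) (B : Fin 4 → Finset ι) (m : ℕ)
    (c : Fin m → Fin 4) :
    0 ≤ msahiE (prodBernoulli p) m (fun l => ind {ω : Set ι | ∃ a ∈ B (c l), a ∈ ω}) := by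
  refine msahiE_prodBernoulli_hit_nonneg_of_width_le_four p m (fun l => B (c l)) fun S hS => ?_
  have hlt : (Finset.univ : Finset (Fin 4)).card < S.card := by simp [hS]
  obtain ⟨i, hi, j, hj, hij, hc⟩ := Finset.exists_ne_map_eq_of_card_lt_of_maps_to hlt (f := c) fun _ _ => Finset.mem_univ _
  exact ⟨i, hi, j, hj, hij, by simp [hc]⟩

end SahiHitting

end Summit.CriticalPhenomena.PercolationContinuityZ3.Theorems
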